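/-
Copyright (c) 2026 the pub-hodgecm-mathlib formalisation cell (harness21).  Prover seat hodgecm-mathlib-K2Liu-p10 (g5), Track B «K2-LIT»,
#184♮ = hLiu418 = `stmt-HodgeConjecture-24832`; (σ) endgame organ, the `hne` transport letter, FILE T2: the Siegel intertwining integral under `f ↦ f ∘ Ad d_a`.
-/
import Summits.HodgeConjecture.HodgeConjecture.Theorems.K2LiuDeltaSimilitudeGroup       -- ★ T1 p861412 (`adDeltaSimil`, block action, invariances)
import Summits.HodgeConjecture.HodgeConjecture.Theorems.K2LiuLocalSiegelCharacterMul    -- ★ `isUnit_detDelta`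
import Mathlib.MeasureTheory.Measure.Haar.Unique
import HarnessLib

/-!
# Crux `HLiu418`, (σ) endgame, `hne` transport letter, FILE T2: `M_v(s)(f ∘ Ad d_a)(h) = χ_v·|·|(m_{a⁻¹}) · M_v(s)(f)(Ad d_a h)` UP TO THE HAAR RESCALING OF `N_Δ`

Cell `hodgecm-mathlib`, crux item hLiu418 = `stmt-HodgeConjecture-24832`, route of record `HCCMUnconditional`; squad K2 ∕ K2Liu, prover K2Liu-p10 (g5); organ lead K2Liu-p09 (g7).
DEFINITIONS WITH BODIES (`leviScalar`, `adUnip`) + theorems; no instance, no notation, no named fact, no `sorry`; definition lane, `--supports stmt-HodgeConjecture-24832 --as helper`.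
★ K2Lit generic currency `(F E c hcδ hδ hd v n hT₀ hJD)`.

* §1 **`leviScalar t = m(t·1_Δ) ∈ M_Δ`** (adapted matrix `diag(t, t⁻¹)`), a Siegel element; **`adDeltaSimil_weylDelta : Ad d_a (w_Δ) = m_{a⁻¹} · w_Δ`**.
* §2 **`adUnip a : N_Δ(F_v) ≃ₜ* N_Δ(F_v)`**, the restriction of `Ad d_a` (★∕📤 T1 `adDeltaSimil_mem_unipDeltaLocal_iff`).
* §3 **`localIntertwining_comp_adDeltaSimil`**: for a Siegel section `f ∈ I_v(s, χ_v)`,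
  `M_v(f ∘ Ad d_a)(h) = localSiegelCharacter χ_v s (m_{a⁻¹}) · ∫_{N_Δ} f(w_Δ u′ Ad d_a h) d((Ad d_a)_* νN)(u′)` (change of variables, NO integrability needed), and with Haar
  uniqueness on the second countable `N_Δ(F_v)`: **`localIntertwining_comp_adDeltaSimil_eq_smul`** — `= localSiegelCharacter χ_v s (m_{a⁻¹}) · c_a • M_v(f)(Ad d_a h)` with
  `c_a = haarScalarFactor ((Ad d_a)_* νN) νN > 0` (`haarScalarFactor_adUnip_pos`); `localSiegelCharacter_leviScalar_ne_zero`.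

HONEST LABEL: HC_CM is proved only modulo the 7 printed citations (2 remaining named inputs: hLiu418 = stmt-HodgeConjecture-24832, h413 = stmt-HodgeConjecture-24833)
until rung 0 closes; this file defines two carriers and closes no item.
References: [Casselman1980] §3; [HarrisKudlaSweet1996] §1 (1.15), §6 (6.14); [Kudla1994] §3; [WeilBNT1967] Ch. II §4 (modulus of an automorphism).
-/

set_option autoImplicit false
set_option linter.dupNamespace false -- the mandated namespace repeats `HodgeConjecture.HodgeConjecture`

noncomputable section

open scoped Matrix NNReal ENNReal
open NumberField IsDedekindDomain Matrix Topology MeasureTheory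
open Literature.NumberTheory.Automorphic Literature.NumberTheory.Automorphic.UnitaryGroup
open Literature.NumberTheory.GelbartRogawski1991
open Literature.NumberTheory.GelbartRogawski1991.UnitaryDualPair
open Literature.NumberTheory.GelbartRogawski1991.UnitaryDualPair.LocalSplitting
open Literature.NumberTheory.GelbartRogawski1991.AdaptedBlocks
open Literature.NumberTheory.K2Lit.LocalSiegelDoubled
open Summit.HodgeConjecture.HodgeConjecture.Cruxes.HLiu418.K2LiuLocalSiegel
open Summit.HodgeConjecture.HodgeConjecture.Cruxes.HLiu418.K2LiuDeltaSimilitudeGroup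

namespace Summit.HodgeConjecture.HodgeConjecture.Cruxes.HLiu418.K2LiuDeltaSimilitudeIntertwining

variable (F : Type) [Field F] [NumberField F] (E : Type) [Field E] [NumberField E] [Algebra F E]
  [Algebra.IsQuadraticExtension F E] (c : E ≃ₐ[F] E)
  {δ : E} (hcδ : c δ = -δ) (hδ : δ ≠ 0) {d : F} (hd : δ * δ = algebraMap F E d)
  (v : HeightOneSpectrum (𝓞 F)) (n : ℕ) {T₀ : Matrix (Fin n) (Fin n) F} (hT₀ : T₀.IsSymm)
  {JD : Matrix (Fin (n + n)) (Fin (n + n)) E} (hJD : JD = (gramD F n T₀).map (algebraMap F E))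

/-! ## §1 The scalar Levi element `m_t` and `Ad d_a (w_Δ) = m_{a⁻¹} w_Δ` -/

section LeviY

variable {S : Type*} [CommRing S] (σ : S →+* S)

/-- `diag(t·1, t′·1)` in the adapted frame. [cite: Kudla1994, §3] -/
def leviY (n : ℕ) (t t' : S) : Matrix (Fin n ⊕ Fin n) (Fin n ⊕ Fin n) S :=
  Matrix.fromBlocks (t • (1 : Matrix (Fin n) (Fin n) S)) 0 0 (t' • (1 : Matrix (Fin n) (Fin n) S))

/-- `diag(t, t′)ᴴ = diag(t, t′)` when `σ` fixes `t, t′`. [cite: Kudla1994, §3] -/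
theorem cstar_leviY {t t' : S} (ht : σ t = t) (ht' : σ t' = t') : ((leviY n t t').map σ)ᵀ = leviY n t t' := by
  have h1 : ∀ {r : S}, σ r = r → ((r • (1 : Matrix (Fin n) (Fin n) S)).map σ) = r • (1 : Matrix (Fin n) (Fin n) S) := fun {r} hr => by
    ext i j
    simp only [Matrix.map_apply, Matrix.smul_apply, smul_eq_mul, map_mul, hr, Matrix.one_apply]
    split_ifs <;> simp
  rw [leviY, Matrix.fromBlocks_map, Matrix.fromBlocks_transpose, Matrix.map_zero _ (map_zero _), h1 ht, h1 ht', Matrix.transpose_zero, Matrix.transpose_smul,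
    Matrix.transpose_smul, Matrix.transpose_one]

/-- `diag(t, t′)` preserves `antidiag(2T, 2T)` when `t t′ = 1`. [cite: Kudla1994, §3] -/
theorem cstar_leviY_mul_antidiag_mul {t t' : S} (ht : σ t = t) (ht' : σ t' = t') (htt : t * t' = 1) (T : Matrix (Fin n) (Fin n) S) :
    ((leviY n t t').map σ)ᵀ * Matrix.fromBlocks 0 ((2 : S) • T) ((2 : S) • T) 0 * leviY n t t' = Matrix.fromBlocks 0 ((2 : S) • T) ((2 : S) • T) 0 := by
  have htt' : t' * t = 1 := by rw [mul_comm, htt]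
  rw [cstar_leviY n σ ht ht', leviY, Matrix.fromBlocks_multiply, Matrix.fromBlocks_multiply]
  simp only [Matrix.mul_zero, Matrix.zero_mul, add_zero, zero_add, Matrix.smul_mul, Matrix.mul_smul, Matrix.one_mul, Matrix.mul_one, smul_smul, smul_zero]
  rw [show t' * (2 * t) = 2 by rw [mul_left_comm, htt', mul_one], show t * (2 * t') = 2 by rw [mul_left_comm, htt, mul_one]]

/-- `det diag(t·1, t′·1) = tⁿ t′ⁿ`. [cite: Kudla1994, §3] -/
theorem det_leviY (t t' : S) : (leviY n t t').det = t ^ n * t' ^ n := by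
  rw [leviY, Matrix.det_fromBlocks_zero₂₁, Matrix.det_smul, Matrix.det_smul, Matrix.det_one, mul_one, mul_one, Fintype.card_fin]

/-- `diag(t, t′) · antidiag(1, 1) = [[0, t], [t′, 0]]`. [cite: Kudla1994, §3] -/
theorem leviY_mul_weylAd (t t' : S) :
    leviY n t t' * Matrix.fromBlocks 0 1 1 0 = Matrix.fromBlocks 0 (t • (1 : Matrix (Fin n) (Fin n) S)) (t' • (1 : Matrix (Fin n) (Fin n) S)) 0 := by
  rw [leviY, Matrix.fromBlocks_multiply]
  simp only [Matrix.mul_zero, add_zero, zero_add, Matrix.mul_one]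

end LeviY

omit [Algebra.IsQuadraticExtension F E] in
/-- `ι(t) ι(t⁻¹) = 1` in `E ⊗ F_v`. [folklore] -/
theorem toLocalRing_mul_toLocalRing_inv (t : (v.adicCompletion F)ˣ) :
    toLocalRing E v (t : v.adicCompletion F) * toLocalRing E v ((t⁻¹ : (v.adicCompletion F)ˣ) : v.adicCompletion F) = 1 := by
  rw [← map_mul, ← Units.val_mul, mul_inv_cancel, Units.val_one, map_one]

omit [Algebra.IsQuadraticExtension F E] in
/-- `det diag(ι t, ι t⁻¹)` is a unit. [cite: Kudla1994, §3] -/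
theorem isUnit_det_leviY (t : (v.adicCompletion F)ˣ) :
    IsUnit (leviY n (toLocalRing E v (t : v.adicCompletion F)) (toLocalRing E v ((t⁻¹ : (v.adicCompletion F)ˣ) : v.adicCompletion F))).det := by
  rw [det_leviY, ← map_pow, ← map_pow]
  exact ((t.isUnit.pow _).map _).mul ((t⁻¹.isUnit.pow _).map _)

include hJD in
/-- **`m_t := m(t·1_Δ) ∈ H_v`**, the Levi element with adapted matrix `diag(t·1, t⁻¹·1)`. [cite: Kudla1994, §3] [cite: HarrisKudlaSweet1996, §1 (1.11)] -/
def leviScalar (t : (v.adicCompletion F)ˣ) : UnitaryGroup.localPi E c (n + n) JD v :=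
  ofAdapted F E c v n hJD (leviY n (toLocalRing E v (t : v.adicCompletion F)) (toLocalRing E v ((t⁻¹ : (v.adicCompletion F)ˣ) : v.adicCompletion F)))
    (isUnit_det_leviY F E v n t)
    (cstar_leviY_mul_antidiag_mul n (conjLocal E c v) (conjLocal_toLocalRing c v _) (conjLocal_toLocalRing c v _) (toLocalRing_mul_toLocalRing_inv F E v t)
      (gramS F E v n T₀))

omit [Algebra.IsQuadraticExtension F E] in
include hJD in
/-- the adapted matrix of `m_t`. [cite: Kudla1994, §3] -/
theorem adapt_matA_leviScalar (t : (v.adicCompletion F)ˣ) :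
    adapt (matA F E c v n (leviScalar F E c v n hJD t)) =
      leviY n (toLocalRing E v (t : v.adicCompletion F)) (toLocalRing E v ((t⁻¹ : (v.adicCompletion F)ˣ) : v.adicCompletion F)) :=
  adapt_matA_ofAdapted F E c v n hJD _ _ _

include hcδ hδ hd hT₀ in
/-- `m_t ∈ P_Δ(F_v)` (`C = 0`). [cite: Kudla1994, §3] -/
theorem isSiegelDelta_leviScalar (t : (v.adicCompletion F)ˣ) : IsSiegelDelta F E c hcδ hδ hd v n hT₀ hJD (leviScalar F E c v n hJD t) := by
  rw [isSiegelDelta_iff_blkC_eq_zero F E c hcδ hδ hd v n hT₀ hJD, blkC_eq_toBlocks₂₁_adapt, adapt_matA_leviScalar, leviY, Matrix.toBlocks_fromBlocks₂₁]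

include hcδ hδ hd hT₀ in
/-- the Siegel character of a Siegel element is non-zero (`χ_v(det_Δ)` is a unit, `|det_Δ|_v > 0`). [cite: HarrisKudlaSweet1996, §1 (1.15)] -/
theorem localSiegelCharacter_ne_zero_of_isSiegelDelta (χv : ∀ w : PlacesOver E v, (w.1.adicCompletion E)ˣ →* ℂˣ) (s : ℂ)
    {p : UnitaryGroup.localPi E c (n + n) JD v} (hp : IsSiegelDelta F E c hcδ hδ hd v n hT₀ hJD p) :
    localSiegelCharacter F E c v n χv s p ≠ 0 := by
  unfold localSiegelCharacter
  have hpos : 0 < absDetDelta F E c v n p :=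
    Finset.prod_pos fun w _ => norm_pos_iff.2 (isUnit_detDelta F E c hcδ hδ hd v n hT₀ hJD _ hp w).ne_zero
  have hne : ((absDetDelta F E c v n p : ℝ) : ℂ) ≠ 0 := Complex.ofReal_ne_zero.2 hpos.ne'
  refine mul_ne_zero (Units.ne_zero _) ?_
  rw [Ne, Complex.cpow_eq_zero_iff, not_and_or]
  exact Or.inl hne

omit [Algebra.IsQuadraticExtension F E] in
include hJD in
/-- **`Ad d_a (w_Δ) = m_{a⁻¹} · w_Δ`** (adapted matrices: `diag(1,a)·antidiag(1,1)·diag(1,a⁻¹) = [[0, a⁻¹], [a, 0]] = diag(a⁻¹, a)·antidiag(1,1)`).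
[cite: Kudla1994, §3] [cite: Casselman1980, §3] -/
theorem adDeltaSimil_weylDelta (a : (v.adicCompletion F)ˣ) :
    adDeltaSimil F E c v n hJD a (weylDelta F E c v n hJD) = leviScalar F E c v n hJD a⁻¹ * weylDelta F E c v n hJD := by
  apply matA_injective F E c v n
  have hw : adapt (matA F E c v n (weylDelta F E c v n hJD)) = Matrix.fromBlocks 0 1 1 0 := by
    rw [weylDelta, adapt_matA_ofAdapted]
  obtain ⟨hA, hB, hC, hD⟩ := Matrix.fromBlocks_inj.1 ((adapt_eq _).symm.trans hw)
  have key : adapt (matA F E c v n (adDeltaSimil F E c v n hJD a (weylDelta F E c v n hJD))) =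
      adapt (matA F E c v n (leviScalar F E c v n hJD a⁻¹ * weylDelta F E c v n hJD)) := by
    rw [adapt_matA_adDeltaSimil, hA, hB, hC, hD, ← matA_mul, adapt_mul, hw, adapt_matA_leviScalar, leviY_mul_weylAd, inv_inv]
  rw [← cayR_mul_adapt_mul_cayRinv (matA F E c v n (adDeltaSimil F E c v n hJD a (weylDelta F E c v n hJD))), key, cayR_mul_adapt_mul_cayRinv]

/-! ## §2 `Ad d_a` restricted to `N_Δ(F_v)` -/

include hJD in
/-- **`adUnip a : N_Δ(F_v) ≃ₜ* N_Δ(F_v)`**, the restriction of `Ad d_a` (★∕📤 T1 `adDeltaSimil_mem_unipDeltaLocal_iff`). [cite: Kudla1994, §3] [cite: Casselman1980, §3] -/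
def adUnip (a : (v.adicCompletion F)ˣ) : ↥(unipDeltaLocal F E c v n (JD := JD)) ≃ₜ* ↥(unipDeltaLocal F E c v n (JD := JD)) where
  toFun u := ⟨adDeltaSimil F E c v n hJD a u, (adDeltaSimil_mem_unipDeltaLocal_iff F E c v n hJD a _).2 u.2⟩
  invFun u := ⟨(adDeltaSimil F E c v n hJD a).symm u, (adDeltaSimil_mem_unipDeltaLocal_iff F E c v n hJD a _).1
    (by rw [ContinuousMulEquiv.apply_symm_apply]; exact u.2)⟩
  left_inv u := Subtype.ext ((adDeltaSimil F E c v n hJD a).symm_apply_apply _)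
  right_inv u := Subtype.ext ((adDeltaSimil F E c v n hJD a).apply_symm_apply _)
  map_mul' u w := Subtype.ext (by simp only [Subgroup.coe_mul, map_mul])
  continuous_toFun := ((adDeltaSimil F E c v n hJD a).continuous.comp continuous_subtype_val).subtype_mk _
  continuous_invFun := ((adDeltaSimil F E c v n hJD a).symm.continuous.comp continuous_subtype_val).subtype_mk _

omit [Algebra.IsQuadraticExtension F E] in
include hJD in
/-- unfolding: `↑(adUnip a u) = Ad d_a ↑u`. [cite: Kudla1994, §3] -/
theorem coe_adUnip (a : (v.adicCompletion F)ˣ) (u : ↥(unipDeltaLocal F E c v n (JD := JD))) :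
    ((adUnip F E c v n hJD a u : ↥(unipDeltaLocal F E c v n (JD := JD))) : UnitaryGroup.localPi E c (n + n) JD v) =
      adDeltaSimil F E c v n hJD a (u : UnitaryGroup.localPi E c (n + n) JD v) :=
  rfl

/-! ## §3 The intertwining integral under `f ↦ f ∘ Ad d_a` -/

section Intertwining

variable [MeasurableSpace ↥(unipDeltaLocal F E c v n (JD := JD))] [BorelSpace ↥(unipDeltaLocal F E c v n (JD := JD))]
  (νN : Measure ↥(unipDeltaLocal F E c v n (JD := JD)))
  (χv : ∀ w : PlacesOver E v, (w.1.adicCompletion E)ˣ →* ℂˣ) (s : ℂ)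

include hcδ hδ hd hT₀ in
/-- **`M_v(f ∘ Ad d_a)(h) = localSiegelCharacter χ_v s (m_{a⁻¹}) · ∫_{N_Δ} f (w_Δ u′ (Ad d_a h)) d((Ad d_a)_* νN)(u′)`** for a Siegel section `f ∈ I_v(s, χ_v)` —
the change of variables `u′ = Ad d_a u` on `N_Δ(F_v)` and `Ad d_a (w_Δ) = m_{a⁻¹} w_Δ`; no integrability needed. [cite: Casselman1980, §3] [cite: HarrisKudlaSweet1996, §6 (6.14)] -/
theorem localIntertwining_comp_adDeltaSimil {f : UnitaryGroup.localPi E c (n + n) JD v → ℂ}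
    (hf : IsLocalSiegelSection F E c hcδ hδ hd v n hT₀ hJD χv s f) (a : (v.adicCompletion F)ˣ) (h : UnitaryGroup.localPi E c (n + n) JD v) :
    localIntertwining F E c v n hJD νN (f ∘ adDeltaSimil F E c v n hJD a) h =
      localSiegelCharacter F E c v n χv s (leviScalar F E c v n hJD a⁻¹) *
        localIntertwining F E c v n hJD (Measure.map (adUnip F E c v n hJD a) νN) f (adDeltaSimil F E c v n hJD a h) := by
  simp only [localIntertwining, Function.comp_apply, map_mul, adDeltaSimil_weylDelta]
  rw [show (⇑(adUnip F E c v n hJD a) : ↥(unipDeltaLocal F E c v n (JD := JD)) → ↥(unipDeltaLocal F E c v n (JD := JD))) =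
      ⇑((adUnip F E c v n hJD a).toHomeomorph.toMeasurableEquiv) from rfl, integral_map_equiv, ← integral_const_mul]
  refine integral_congr_ae (Filter.Eventually.of_forall fun u => ?_)
  show f (leviScalar F E c v n hJD a⁻¹ * weylDelta F E c v n hJD * adDeltaSimil F E c v n hJD a (u : UnitaryGroup.localPi E c (n + n) JD v) *
      adDeltaSimil F E c v n hJD a h) =
    localSiegelCharacter F E c v n χv s (leviScalar F E c v n hJD a⁻¹) *
      f (weylDelta F E c v n hJD * adDeltaSimil F E c v n hJD a (u : UnitaryGroup.localPi E c (n + n) JD v) * adDeltaSimil F E c v n hJD a h)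
  rw [mul_assoc (leviScalar F E c v n hJD a⁻¹), mul_assoc (leviScalar F E c v n hJD a⁻¹), hf _ (isSiegelDelta_leviScalar F E c hcδ hδ hd v n hT₀ hJD a⁻¹),
    mul_assoc]

omit [Algebra.IsQuadraticExtension F E] [BorelSpace ↥(unipDeltaLocal F E c v n (JD := JD))] in
include hJD in
/-- `M_v` is homogeneous in the measure: `M_v^{c • ν}(f) = c • M_v^{ν}(f)`. [cite: Casselman1980, §3] -/
theorem localIntertwining_smul_measure (r : ℝ≥0) (f : UnitaryGroup.localPi E c (n + n) JD v → ℂ) (h : UnitaryGroup.localPi E c (n + n) JD v) :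
    localIntertwining F E c v n hJD (r • νN) f h = r • localIntertwining F E c v n hJD νN f h := by
  simp only [localIntertwining, integral_smul_nnreal_measure]

variable [LocallyCompactSpace ↥(unipDeltaLocal F E c v n (JD := JD))] [SecondCountableTopology ↥(unipDeltaLocal F E c v n (JD := JD))] [νN.IsHaarMeasure]

omit [Algebra.IsQuadraticExtension F E] [LocallyCompactSpace ↥(unipDeltaLocal F E c v n (JD := JD))]
  [SecondCountableTopology ↥(unipDeltaLocal F E c v n (JD := JD))] in
include hJD in
/-- **the Haar rescaling constant of `Ad d_a` on `N_Δ(F_v)` is positive**: `0 < c_a := haarScalarFactor ((Ad d_a)_* νN) νN`.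
[cite: WeilBNT1967, Ch. II §4] [cite: Casselman1980, §3] -/
theorem haarScalarFactor_adUnip_pos (a : (v.adicCompletion F)ˣ) :
    0 < Measure.haarScalarFactor (Measure.map (adUnip F E c v n hJD a) νN) νN :=
  Measure.haarScalarFactor_pos_of_isHaarMeasure _ _

omit [Algebra.IsQuadraticExtension F E] in
include hJD in
/-- `(Ad d_a)_* νN = c_a • νN` (Haar uniqueness on the second countable `N_Δ(F_v)`). [cite: WeilBNT1967, Ch. II §4] -/
theorem map_adUnip_eq_smul (a : (v.adicCompletion F)ˣ) :
    Measure.map (adUnip F E c v n hJD a) νN = Measure.haarScalarFactor (Measure.map (adUnip F E c v n hJD a) νN) νN • νN :=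
  Measure.isMulLeftInvariant_eq_smul _ _

include hcδ hδ hd hT₀ in
/-- **`M_v(f ∘ Ad d_a)(h) = localSiegelCharacter χ_v s (m_{a⁻¹}) · c_a • M_v(f)(Ad d_a h)`**, `c_a > 0` the Haar rescaling constant of `Ad d_a` on `N_Δ(F_v)`
(`haarScalarFactor_adUnip_pos`), for every Siegel section `f ∈ I_v(s, χ_v)` and every Haar `νN`. [cite: Casselman1980, §3] [cite: HarrisKudlaSweet1996, §6 (6.14)] [cite: WeilBNT1967, Ch. II §4] -/
theorem localIntertwining_comp_adDeltaSimil_eq_smul {f : UnitaryGroup.localPi E c (n + n) JD v → ℂ}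
    (hf : IsLocalSiegelSection F E c hcδ hδ hd v n hT₀ hJD χv s f) (a : (v.adicCompletion F)ˣ) (h : UnitaryGroup.localPi E c (n + n) JD v) :
    localIntertwining F E c v n hJD νN (f ∘ adDeltaSimil F E c v n hJD a) h =
      localSiegelCharacter F E c v n χv s (leviScalar F E c v n hJD a⁻¹) *
        (Measure.haarScalarFactor (Measure.map (adUnip F E c v n hJD a) νN) νN • localIntertwining F E c v n hJD νN f (adDeltaSimil F E c v n hJD a h)) := by
  rw [localIntertwining_comp_adDeltaSimil F E c hcδ hδ hd v n hT₀ hJD νN χv s hf a h]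
  conv_lhs => rw [map_adUnip_eq_smul F E c v n hJD νN a]
  rw [localIntertwining_smul_measure]

end Intertwining

end Summit.HodgeConjecture.HodgeConjecture.Cruxes.HLiu418.K2LiuDeltaSimilitudeIntertwining

end
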